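import Summits.QuantumFields.YangMills.Theorems.UnitScaleTiltProp7SolutionHessianSupOfRegPr
import Summits.QuantumFields.YangMills.Theorems.UnitScaleTiltSmoothLiftFibre
import HarnessLib

/-!
# Route `UnitScaleTilt`, crux K1 «MinimiserStabilityRegPr» (stmt-QuantumFields-19200), EX row (5) `h3` (STOREY H), H-ROAD brick **H2b-GLUE: THE COVARIANT ½-HÖLDER LETTER OF H7
# FROM A PLAIN MODULUS AND THE MODULUS OF THE AXIAL TRANSPORTER** — the Hilbert-side half of the bridge H2 → H7 (★p1 g28 CHAIR WORD №46∕№48: H2 = px19 g15, H7 = px13 g16).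

Cell `ym3-torus` (HUMAN RULING D-0037; rung R3 = SU(2) YM₃ on T³ — NOT d = 4, NOT infinite volume, NOT a mass gap, NOT Clay).  Width seat `ym3-torus-px13` (gen 16);
`--supports stmt-QuantumFields-19200 --as helper`; count-neutral; THEOREMS ONLY (0 `def`, 0 `sorry`, default heartbeats).

WHY.  H7 ✓`Prop7SolutionHessianSupOfRegPr.norm_covGradT_DL2_le_of_holderLetters` (and H7-R ✓∕⧗`…SupAllMembers`, H8 ✓`Prop7StoreyHGradientRow.h3_of_holderLetters`) consume the
½-Hölder row of `ω` in the ONE gauge-invariant currency available at a curved background: the modulus of `ω` TRANSPORTED TO THE CENTRE ALONG THE AXIAL TREE,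
`y ↦ σ_c(y)·ω(y)·σ_c(y)*`, `σ_c := axialT U₀ c` (= plain differences of `Φ_{σ_c}ω` by ✓`exists_adIsometries`' formula clause).  The supplier H2 ([Balaban1985BackgroundPropagators]
Thm 3.1 (3.42), Hölder entry) naturally produces a PLAIN modulus of `ω` in a gauge `U₀` where the field is small ([Balaban1985RegularSpaces] Thm 2 = S47's `hThm2S`), and the (★)
lineage (px19 ✓`AxialGaugeMemberModulus`, comb walk ✓`AxialGaugeCombWalk`) produces moduli of the axial TRANSPORTER.  This file is the algebra in between:
* §1 — ONE IDENTITY for the transporter's step: `V(b)·σ(b₊) = σ(b₋)·U₀(b)` for `V := U₀^σ` (the definition of the gauge action), hence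
  `‖σ(x+e_κ) − σ(x)‖ ≤ ‖V(x,κ) − 1‖ + ‖U₀(x,κ) − 1‖` for ANY `σ` — with `σ := axialT U₀ c` the first term is the axial smallness on the no-wrap ball
  (✓`Prop7CurvedMemberBallLetters.norm_bgOfCfg_axialT_sub_one_le_of_ball`: `≤ 3R·ε₀η²`, plaquettes only) and the second the small-field clause `‖U₀(b) − 1‖ ≤ aη` of a regular gauge:
  NO gradient clause is needed; summing `≤ 3d` such steps along a path inside the ball is the comb walk (px19's currency, not redone here);
* §2 — the fibre inequality `‖(σ′X′σ′*)^∨ − (σXσ*)^∨‖ ≤ ‖X′^∨ − X^∨‖ + 2√2·‖σ′ − σ‖·‖X^∨‖` (`^∨ = frobEquiv⁻¹`, Frobenius norm; `σ, σ′ ∈ SU(2)`);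
* §3 — ★★ THE GLUE: plain modulus `H`, sup `N_ω` and transporter modulus `Λ` on the balls `tdist (e c) · ≤ 4ℓ+1` ⟹ H7's `hHω` binder VERBATIM with `H_ω := H + 2√2·Λ·N_ω`.

WHAT IS PROVED (ns `Summit.QuantumFields.YangMills.Theorems.Prop7AxialHolderLetterGlue`; member `F`, run `K`, weight `c₀ > 0`).
* §1 `gaugeAct_mul_transf_tgt` (`V(b)·σ(b₊) = σ(b₋)·U₀(b)` in `SU(2)`) · ★`norm_coe_transf_tgt_sub_le` (`‖σ(b₊) − σ(b₋)‖ ≤ ‖V(b) − 1‖ + ‖U₀(b) − 1‖`, operator norms).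
* §2 `norm_frobEquiv_symm_mul_mul_le` · ★`norm_frobEquiv_symm_conj_sub_conj_le` (unitary norms `≤ 1` by ✓`SmoothLiftFibre.norm_coe_su2_le`).
* §3 ★★ `hHω_of_plain_of_transporter` — the H7∕H8 letter from (`hN`, `hH`, `hΛ`).
HYP-SAT (★★OWNER RULING №42).  §1–§2 are identities∕inequalities with no hypotheses beyond membership in `SU(2)`; §3's three letters are real sup∕modulus letters (inhabited at fixed
data by finite maxima; K-free on the H-road by H2 and the (★) row); conclusion = H7's `hHω` text; no `Prop` hypothesis restates it.  HONEST SCOPE: algebra; the comb walk (path inside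
the ball), H2, and the regular gauge are NOT here; nothing of `h3`, norm_G, EX, 19200 or the rung is proved; the Yang–Mills mass gap is NOT proved.

References: T. Bałaban, CMP **99** (1985) 389–434 [Balaban1985BackgroundPropagators] ((3.28) p.395, (3.35) p.396, Thm 3.1 (3.42) p.397); CMP **98** (1985) 17–51
[Balaban1985Averaging] ((8) p.19, (18) p.21, pp.24–25); CMP **102** (1985) 255–275 [Balaban1985RegularSpaces] ((1.36)–(1.37) p.82, Thm 2 p.83).
-/

set_option autoImplicit false

noncomputable section

open scoped BigOperators Matrix.Norms.L2Operator InnerProductSpace ComplexConjugate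

namespace Summit.QuantumFields.YangMills.Theorems.Prop7AxialHolderLetterGlue

open Literature.MathematicalPhysics.QuantumFieldTheory.Balaban1983to89
open Literature.MathematicalPhysics.QuantumFieldTheory.Balaban1983to89.T3ContinuumYM3Torus
open B10Eq27TorusAxialLog (axialT)
open B4Sect5Torus (TSite tdist)
open B9Eq311L2Pairing (WL2)
open B11Eq103H1Complex (SiteL2K)
open Summit.QuantumFields.YangMills.Theorems.Prop7SectET3Transport (periodsT3 siteEquiv)
open Summit.QuantumFields.YangMills.Theorems.Prop7SectET3HilbertLetters (W₂ frobEquiv toL2S toL2S_apply toL2S_symm_apply)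
open Summit.QuantumFields.YangMills.Theorems.Prop7RieszTauFrobNorm (norm_le_norm_frobEquiv_symm norm_frobEquiv_symm_le)
open Summit.QuantumFields.YangMills.Theorems.Prop7GaugeCovariancePointwise (norm_frobEquiv_symm_conj_eq)
open Summit.QuantumFields.YangMills.Theorems.SmoothLiftFibre (norm_coe_su2_le)

/-! ## §1 The transporter's step: one identity, one inequality -/

section Step

variable {P : Params} {j : ℕ}

/-- **`V(b)·σ(b₊) = σ(b₋)·U₀(b)`** for `V := U₀^σ` — the definition of the gauge action `U^σ(b) = σ(b₋)U(b)σ(b₊)⁻¹` ([Balaban1985Averaging] (8)), multiplied back.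
[cite: Balaban1985Averaging, (8) p.19; Balaban1985BackgroundPropagators, (3.28) p.395] -/
theorem gaugeAct_mul_transf_tgt (σ : GaugeTransf P j (Matrix.specialUnitaryGroup (Fin 2) ℂ)) (U : GaugeField P j (Matrix.specialUnitaryGroup (Fin 2) ℂ)) (b : PBond P j) :
    GaugeField.gaugeAct σ U b * σ b.tgt = σ b.src * U b := by
  rw [GaugeField.gaugeAct, inv_mul_cancel_right]

/-- ★ **THE STEP OF ANY GAUGE TRANSFORMATION ALONG A BOND IS CONTROLLED BY THE TWO LINK DEVIATIONS**: `‖σ(b₊) − σ(b₋)‖ ≤ ‖U₀^σ(b) − 1‖ + ‖U₀(b) − 1‖` (operator norms) —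
`σ(b₊) − σ(b₋) = (1 − V(b))σ(b₊) + σ(b₋)(U₀(b) − 1)` by §1's identity, unitary factors have norm `≤ 1`.  With `σ := axialT U₀ c` the first deviation is the axial smallness on the
no-wrap ball and the second the small-field clause of a regular gauge. [cite: Balaban1985Averaging, (8) p.19, pp.24-25; Balaban1985BackgroundPropagators, (3.35) p.396] -/
theorem norm_coe_transf_tgt_sub_le (σ : GaugeTransf P j (Matrix.specialUnitaryGroup (Fin 2) ℂ)) (U : GaugeField P j (Matrix.specialUnitaryGroup (Fin 2) ℂ)) (b : PBond P j) :
    ‖(σ b.tgt : Matrix (Fin 2) (Fin 2) ℂ) - (σ b.src : Matrix (Fin 2) (Fin 2) ℂ)‖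
      ≤ ‖((GaugeField.gaugeAct σ U b : Matrix.specialUnitaryGroup (Fin 2) ℂ) : Matrix (Fin 2) (Fin 2) ℂ) - 1‖ + ‖((U b : Matrix.specialUnitaryGroup (Fin 2) ℂ) : Matrix (Fin 2) (Fin 2) ℂ) - 1‖ := by
  have h := congrArg (fun g : Matrix.specialUnitaryGroup (Fin 2) ℂ => (g : Matrix (Fin 2) (Fin 2) ℂ)) (gaugeAct_mul_transf_tgt σ U b)
  simp only [Submonoid.coe_mul] at h
  set V : Matrix (Fin 2) (Fin 2) ℂ := ((GaugeField.gaugeAct σ U b : Matrix.specialUnitaryGroup (Fin 2) ℂ) : Matrix (Fin 2) (Fin 2) ℂ) with hV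
  set s' : Matrix (Fin 2) (Fin 2) ℂ := (σ b.tgt : Matrix (Fin 2) (Fin 2) ℂ) with hs'
  set s : Matrix (Fin 2) (Fin 2) ℂ := (σ b.src : Matrix (Fin 2) (Fin 2) ℂ) with hs
  set u : Matrix (Fin 2) (Fin 2) ℂ := ((U b : Matrix.specialUnitaryGroup (Fin 2) ℂ) : Matrix (Fin 2) (Fin 2) ℂ) with hu
  have he : s' - s = (1 - V) * s' + s * (u - 1) := by
    have : V * s' = s * u := h
    calc s' - s = s' - V * s' + (V * s' - s) := by abel
      _ = s' - V * s' + (s * u - s) := by rw [this]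
      _ = (1 - V) * s' + s * (u - 1) := by noncomm_ring
  rw [he]
  have hs'1 : ‖s'‖ ≤ 1 := norm_coe_su2_le _
  have hs1 : ‖s‖ ≤ 1 := norm_coe_su2_le _
  calc ‖(1 - V) * s' + s * (u - 1)‖ ≤ ‖(1 - V) * s'‖ + ‖s * (u - 1)‖ := norm_add_le _ _
    _ ≤ ‖1 - V‖ * ‖s'‖ + ‖s‖ * ‖u - 1‖ := add_le_add (norm_mul_le _ _) (norm_mul_le _ _)
    _ ≤ ‖1 - V‖ * 1 + 1 * ‖u - 1‖ :=
        add_le_add (mul_le_mul_of_nonneg_left hs'1 (norm_nonneg _)) (mul_le_mul_of_nonneg_right hs1 (norm_nonneg _))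
    _ = ‖V - 1‖ + ‖u - 1‖ := by rw [mul_one, one_mul, norm_sub_rev]

end Step

/-! ## §2 The fibre inequality: conjugation by two nearby `SU(2)` elements -/

/-- `‖(A·X·B)^∨‖ ≤ √2·‖A‖·‖X^∨‖·‖B‖` — Frobenius against operator norms through the two-sided comparison `‖Y‖ ≤ ‖Y^∨‖ ≤ √2‖Y‖` on `M₂(ℂ)` (✓`Prop7RieszTauFrobNorm`). [folklore] -/
theorem norm_frobEquiv_symm_mul_mul_le (A X B : Matrix (Fin 2) (Fin 2) ℂ) :
    ‖(frobEquiv.symm (A * X * B) : W₂)‖ ≤ Real.sqrt 2 * ‖A‖ * ‖(frobEquiv.symm X : W₂)‖ * ‖B‖ := by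
  calc ‖(frobEquiv.symm (A * X * B) : W₂)‖ ≤ Real.sqrt 2 * ‖A * X * B‖ := norm_frobEquiv_symm_le _
    _ ≤ Real.sqrt 2 * (‖A‖ * ‖X‖ * ‖B‖) :=
        mul_le_mul_of_nonneg_left ((norm_mul_le _ _).trans (mul_le_mul_of_nonneg_right (norm_mul_le _ _) (norm_nonneg _))) (Real.sqrt_nonneg _)
    _ ≤ Real.sqrt 2 * (‖A‖ * ‖(frobEquiv.symm X : W₂)‖ * ‖B‖) :=
        mul_le_mul_of_nonneg_left (mul_le_mul_of_nonneg_right (mul_le_mul_of_nonneg_left (norm_le_norm_frobEquiv_symm X) (norm_nonneg _)) (norm_nonneg _))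
          (Real.sqrt_nonneg _)
    _ = _ := by ring

/-- ★ **CONJUGATION BY TWO NEARBY `SU(2)` ELEMENTS**: `‖(σ′X′σ′*)^∨ − (σXσ*)^∨‖ ≤ ‖X′^∨ − X^∨‖ + 2√2·‖σ′ − σ‖·‖X^∨‖` —
`σ′X′σ′* − σXσ* = σ′(X′ − X)σ′* + (σ′ − σ)Xσ′* + σX(σ′ − σ)*`, the first term is a Frobenius isometry (✓`norm_frobEquiv_symm_conj_eq`), the other two by §2's comparison with
`‖σ‖, ‖σ′*‖ ≤ 1`, `‖(σ′ − σ)*‖ = ‖σ′ − σ‖`. [cite: Balaban1985Averaging, (18) p.21; Balaban1985BackgroundPropagators, (3.35) p.396] -/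
theorem norm_frobEquiv_symm_conj_sub_conj_le (σ σ' : Matrix.specialUnitaryGroup (Fin 2) ℂ) (X X' : Matrix (Fin 2) (Fin 2) ℂ) :
    ‖(frobEquiv.symm ((σ' : Matrix (Fin 2) (Fin 2) ℂ) * X' * star (σ' : Matrix (Fin 2) (Fin 2) ℂ)) : W₂)
        - (frobEquiv.symm ((σ : Matrix (Fin 2) (Fin 2) ℂ) * X * star (σ : Matrix (Fin 2) (Fin 2) ℂ)) : W₂)‖
      ≤ ‖(frobEquiv.symm X' : W₂) - (frobEquiv.symm X : W₂)‖
        + 2 * Real.sqrt 2 * ‖(σ' : Matrix (Fin 2) (Fin 2) ℂ) - (σ : Matrix (Fin 2) (Fin 2) ℂ)‖ * ‖(frobEquiv.symm X : W₂)‖ := by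
  set s : Matrix (Fin 2) (Fin 2) ℂ := (σ : Matrix (Fin 2) (Fin 2) ℂ) with hs
  set s' : Matrix (Fin 2) (Fin 2) ℂ := (σ' : Matrix (Fin 2) (Fin 2) ℂ) with hs'
  have hsplit : s' * X' * star s' - s * X * star s = s' * (X' - X) * star s' + ((s' - s) * X * star s' + s * X * star (s' - s)) := by
    rw [star_sub]; noncomm_ring
  have hlin : (frobEquiv.symm (s' * X' * star s') : W₂) - (frobEquiv.symm (s * X * star s) : W₂)
      = (frobEquiv.symm (s' * (X' - X) * star s') : W₂) + ((frobEquiv.symm ((s' - s) * X * star s') : W₂) + (frobEquiv.symm (s * X * star (s' - s)) : W₂)) := by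
    rw [← map_sub, hsplit, map_add, map_add]
  rw [hlin]
  have h1 : ‖(frobEquiv.symm (s' * (X' - X) * star s') : W₂)‖ = ‖(frobEquiv.symm X' : W₂) - (frobEquiv.symm X : W₂)‖ := by
    rw [hs', norm_frobEquiv_symm_conj_eq, map_sub]
  have hs1 : ‖s‖ ≤ 1 := norm_coe_su2_le σ
  have hs'1 : ‖star s'‖ ≤ 1 := by rw [norm_star]; exact norm_coe_su2_le σ'
  have hd : ‖star (s' - s)‖ = ‖s' - s‖ := norm_star _
  have h2 : ‖(frobEquiv.symm ((s' - s) * X * star s') : W₂)‖ ≤ Real.sqrt 2 * ‖s' - s‖ * ‖(frobEquiv.symm X : W₂)‖ := by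
    refine (norm_frobEquiv_symm_mul_mul_le _ _ _).trans ?_
    have h0 : 0 ≤ Real.sqrt 2 * ‖s' - s‖ * ‖(frobEquiv.symm X : W₂)‖ := by positivity
    calc Real.sqrt 2 * ‖s' - s‖ * ‖(frobEquiv.symm X : W₂)‖ * ‖star s'‖ ≤ Real.sqrt 2 * ‖s' - s‖ * ‖(frobEquiv.symm X : W₂)‖ * 1 :=
          mul_le_mul_of_nonneg_left hs'1 h0
      _ = _ := mul_one _
  have h3 : ‖(frobEquiv.symm (s * X * star (s' - s)) : W₂)‖ ≤ Real.sqrt 2 * ‖s' - s‖ * ‖(frobEquiv.symm X : W₂)‖ := by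
    refine (norm_frobEquiv_symm_mul_mul_le _ _ _).trans ?_
    rw [hd]
    have h0 : 0 ≤ Real.sqrt 2 * ‖(frobEquiv.symm X : W₂)‖ * ‖s' - s‖ := by positivity
    calc Real.sqrt 2 * ‖s‖ * ‖(frobEquiv.symm X : W₂)‖ * ‖s' - s‖ = ‖s‖ * (Real.sqrt 2 * ‖(frobEquiv.symm X : W₂)‖ * ‖s' - s‖) := by ring
      _ ≤ 1 * (Real.sqrt 2 * ‖(frobEquiv.symm X : W₂)‖ * ‖s' - s‖) := mul_le_mul_of_nonneg_right hs1 h0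
      _ = Real.sqrt 2 * ‖s' - s‖ * ‖(frobEquiv.symm X : W₂)‖ := by ring
  calc _ ≤ ‖(frobEquiv.symm (s' * (X' - X) * star s') : W₂)‖ + ‖(frobEquiv.symm ((s' - s) * X * star s') : W₂) + (frobEquiv.symm (s * X * star (s' - s)) : W₂)‖ :=
        norm_add_le _ _
    _ ≤ ‖(frobEquiv.symm X' : W₂) - (frobEquiv.symm X : W₂)‖ + (Real.sqrt 2 * ‖s' - s‖ * ‖(frobEquiv.symm X : W₂)‖ + Real.sqrt 2 * ‖s' - s‖ * ‖(frobEquiv.symm X : W₂)‖) := by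
        rw [h1]; exact add_le_add le_rfl ((norm_add_le _ _).trans (add_le_add h2 h3))
    _ = _ := by ring

/-! ## §3 ★★ The glue: H7's covariant ½-Hölder letter from a plain modulus and the transporter's modulus -/

variable (F : T3Family) (n K : ℕ) (c₀ : ℝ)

/-- ★★ **H7's `hHω` LETTER FROM A PLAIN MODULUS AND THE MODULUS OF THE AXIAL TRANSPORTER.**  If on every ball `tdist (e c) · ≤ 4ℓ+1`: `ω` has the sup `N_ω` and the PLAIN ½-Hölder
modulus `H` (`‖ω(y′) − ω(y)‖ ≤ H·(tdist y y′∕ℓ)^{1∕2}`), and the axial transporter `σ_c = axialT U₀ c` has the modulus `Λ` (`‖σ_c(e⁻¹y′) − σ_c(e⁻¹y)‖ ≤ Λ·(tdist y y′∕ℓ)^{1∕2}`, operator norm —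
the (★)∕comb-walk output over §1's step inequality), then H7's covariant letter holds with `H_ω := H + 2√2·Λ·N_ω`:
`‖(σ_c ω σ_c*)~(y′) − (σ_c ω σ_c*)~(y)‖ ≤ (H + 2√2·Λ·N_ω)·(tdist y y′∕ℓ)^{1∕2}` — the binder text of ✓`norm_covGradT_DL2_le_of_holderLetters` VERBATIM (§2 + ✓`toL2S_apply`∕✓`toL2S_symm_apply`).
[cite: Balaban1985BackgroundPropagators, Thm 3.1 (3.42) p.397, (3.35) p.396; Balaban1985Averaging, pp.24-25] -/
theorem hHω_of_plain_of_transporter (U₀ : GaugeField (F.P K) 0 (Matrix.specialUnitaryGroup (Fin 2) ℂ)) (ω : SiteL2K ℂ 3 (periodsT3 F K) c₀ W₂)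
    {Nω H Λ : ℝ} (hΛ0 : 0 ≤ Λ)
    (hN : ∀ y : TSite 3 (periodsT3 F K), ‖WL2.equiv ℂ (fun _ : TSite 3 (periodsT3 F K) => c₀) W₂ ω y‖ ≤ Nω)
    (hH : ∀ (c : Site (F.P K) 0) (y y' : TSite 3 (periodsT3 F K)),
      tdist (periodsT3 F K) (siteEquiv F K c) y ≤ 4 * (F.L : ℝ) ^ (K - n) + 1 → tdist (periodsT3 F K) (siteEquiv F K c) y' ≤ 4 * (F.L : ℝ) ^ (K - n) + 1 →
      ‖WL2.equiv ℂ (fun _ : TSite 3 (periodsT3 F K) => c₀) W₂ ω y' - WL2.equiv ℂ (fun _ : TSite 3 (periodsT3 F K) => c₀) W₂ ω y‖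
        ≤ H * (tdist (periodsT3 F K) y y' / ((F.L : ℝ) ^ (K - n))) ^ ((1 : ℝ) / 2))
    (hΛ : ∀ (c : Site (F.P K) 0) (y y' : TSite 3 (periodsT3 F K)),
      tdist (periodsT3 F K) (siteEquiv F K c) y ≤ 4 * (F.L : ℝ) ^ (K - n) + 1 → tdist (periodsT3 F K) (siteEquiv F K c) y' ≤ 4 * (F.L : ℝ) ^ (K - n) + 1 →
      ‖((axialT U₀ c ((siteEquiv F K).symm y') : Matrix.specialUnitaryGroup (Fin 2) ℂ) : Matrix (Fin 2) (Fin 2) ℂ)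
          - ((axialT U₀ c ((siteEquiv F K).symm y) : Matrix.specialUnitaryGroup (Fin 2) ℂ) : Matrix (Fin 2) (Fin 2) ℂ)‖
        ≤ Λ * (tdist (periodsT3 F K) y y' / ((F.L : ℝ) ^ (K - n))) ^ ((1 : ℝ) / 2)) :
    ∀ (c : Site (F.P K) 0) (y y' : TSite 3 (periodsT3 F K)),
      tdist (periodsT3 F K) (siteEquiv F K c) y ≤ 4 * (F.L : ℝ) ^ (K - n) + 1 → tdist (periodsT3 F K) (siteEquiv F K c) y' ≤ 4 * (F.L : ℝ) ^ (K - n) + 1 →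
      ‖WL2.equiv ℂ (fun _ : TSite 3 (periodsT3 F K) => c₀) W₂
            (toL2S F K c₀ (fun z => ((axialT U₀ c z : Matrix.specialUnitaryGroup (Fin 2) ℂ) : Matrix (Fin 2) (Fin 2) ℂ) * (toL2S F K c₀).symm ω z
              * star ((axialT U₀ c z : Matrix.specialUnitaryGroup (Fin 2) ℂ) : Matrix (Fin 2) (Fin 2) ℂ))) y'
          - WL2.equiv ℂ (fun _ : TSite 3 (periodsT3 F K) => c₀) W₂
            (toL2S F K c₀ (fun z => ((axialT U₀ c z : Matrix.specialUnitaryGroup (Fin 2) ℂ) : Matrix (Fin 2) (Fin 2) ℂ) * (toL2S F K c₀).symm ω z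
              * star ((axialT U₀ c z : Matrix.specialUnitaryGroup (Fin 2) ℂ) : Matrix (Fin 2) (Fin 2) ℂ))) y‖
        ≤ (H + 2 * Real.sqrt 2 * Λ * Nω) * (tdist (periodsT3 F K) y y' / ((F.L : ℝ) ^ (K - n))) ^ ((1 : ℝ) / 2) := by
  intro c y y' hy hy'
  rw [toL2S_apply, toL2S_apply]
  -- `(toL2S⁻¹ ω)(e⁻¹ y)^∨ = ω(y)`
  have hval : ∀ t : TSite 3 (periodsT3 F K), (frobEquiv.symm ((toL2S F K c₀).symm ω ((siteEquiv F K).symm t)) : W₂)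
      = WL2.equiv ℂ (fun _ : TSite 3 (periodsT3 F K) => c₀) W₂ ω t := fun t => by
    rw [toL2S_symm_apply, Equiv.apply_symm_apply, LinearEquiv.symm_apply_apply]
  set s : ℝ := (tdist (periodsT3 F K) y y' / ((F.L : ℝ) ^ (K - n))) ^ ((1 : ℝ) / 2) with hsdef
  have hs0 : 0 ≤ s := by
    have hℓ : (0 : ℝ) ≤ (F.L : ℝ) ^ (K - n) := by positivity
    exact Real.rpow_nonneg (div_nonneg (B4Sect5Torus.tdist_nonneg _ _ _) hℓ) _
  refine (norm_frobEquiv_symm_conj_sub_conj_le _ _ _ _).trans ?_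
  rw [hval, hval]
  have h1 := hH c y y' hy hy'
  have h2 := hΛ c y y' hy hy'
  have h3 := hN y
  calc ‖WL2.equiv ℂ (fun _ : TSite 3 (periodsT3 F K) => c₀) W₂ ω y' - WL2.equiv ℂ (fun _ : TSite 3 (periodsT3 F K) => c₀) W₂ ω y‖
        + 2 * Real.sqrt 2 * ‖((axialT U₀ c ((siteEquiv F K).symm y') : Matrix.specialUnitaryGroup (Fin 2) ℂ) : Matrix (Fin 2) (Fin 2) ℂ)
            - ((axialT U₀ c ((siteEquiv F K).symm y) : Matrix.specialUnitaryGroup (Fin 2) ℂ) : Matrix (Fin 2) (Fin 2) ℂ)‖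
          * ‖WL2.equiv ℂ (fun _ : TSite 3 (periodsT3 F K) => c₀) W₂ ω y‖
      ≤ H * s + 2 * Real.sqrt 2 * (Λ * s) * Nω :=
        add_le_add h1 (mul_le_mul (mul_le_mul_of_nonneg_left h2 (by positivity)) h3 (norm_nonneg _) (by positivity))
    _ = (H + 2 * Real.sqrt 2 * Λ * Nω) * s := by ring

end Summit.QuantumFields.YangMills.Theorems.Prop7AxialHolderLetterGlue

end
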